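import Literature.MathematicalPhysics.QuantumFieldTheory.Balaban1983to89.B11Eq103H1Complex

/-!
# `Balaban1983to89.B11Eq88LaplaceH1Identity` — T. Bałaban, *The variational problem and background fields in renormalization group method for lattice
# gauge theories*, Commun. Math. Phys. **102** (1985) 277–309 [Balaban1985Variational]: (87)–(88) p. 291 (the functional derivative of `⟨A′, Δ_π HD(A′)⟩ =
# ⟨A′, (Δ_π + DRD*)HD(A′)⟩` estimated «applying the inequalities (3.132) from [5], (55), (73), and remembering that the symbol a above represents the
# operator of multiplication by (Lʲη)⁻²»), p. 293 and (129) p. 297 (`Δ_{1,a}H₁ = Q*(QG₁Q*)⁻¹`): **THE GREEN's IDENTITY BEHIND (88) ON THE LATTICE —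
# `(Δ₁ + DRD*)H₁ = Q†((QG₁Q*)⁻¹ − a)`, i.e. the second-order operator `Δ₁ + DRD*` COMPOSED WITH `H₁ = G₁Q*(QG₁Q*)⁻¹` is the BOUNDED averaging-side
# operator `Q†((QG₁Q*)⁻¹ − a)`; and its transposed (pairing) form `⟨H₁b, Δ_{1,a}x⟩ = ⟨(QG₁Q*)⁻¹b, Qx⟩` for a symmetric `Δ_{1,a}`**

WHY (NE9 crux-team leaf prover 01, `b2b-balaban-t4-ne9-formalise-leaf-01`, gen 97; memo `LOCATED-after-g97.md` §2 (E′)).  In the (L3) W-slot `W80` of the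
`cur U` chart the W₂-rows (88) `−(Δ_π HD(A′) + 𝔇*(A′)H*Δ_π A′)` were typed through an operator-norm letter `M_Δ = ‖Δπ‖_{(1,2) → (−3)}`, which is NOT
lattice-free (a divergence-free one-plaquette configuration gives `‖Δπ A′‖₍₋₃₎ ∕ ‖A′‖₍₁,₂₎ ≍ Lʲ ≥ η⁻¹`).  Print never lets `Δ_π` act on a bare configuration:
by (87) only `(Δ_π + DRD*)∘H` and its transpose occur, and with `G₁ = (Δ_π + DRD* + aQ*Q)⁻¹` these are the bounded operators of this file.  The identities
are the abstract `B11Eq103H1Complex.laplaceAK_H1K` ∕ `Q_H1K` read at the lattice letters `laplaceALatticeK`, `H1LatticeK`, `KinvLatticeK` (no new object).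

WHAT THIS FILE PROVES (0 def, 0 sorry, axioms standard).  §1 `laplaceALatticeK_H1LatticeK` — `Δ_{1,a}(H₁b) = Q†(K⁻¹b)`, `K⁻¹ := (QG₁Q*)⁻¹`;
`laplace_add_DRD_H1LatticeK` — `Δ₁(H₁b) + D(R(D*(H₁b))) = Q†(K⁻¹b) − a·Q†b` ((88)'s composite); §2 `inner_H1LatticeK_laplaceALatticeK` — for
`Δ_{1,a}` symmetric (`Δ₁`, `R` symmetric, `D* = D†`): `⟨H₁b, Δ_{1,a}x⟩ = ⟨K⁻¹b, Qx⟩`, and `inner_H1LatticeK_laplace_add_DRD` — `⟨H₁b, Δ₁x + D(R(D*x))⟩ =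
⟨K⁻¹b, Qx⟩ − a⟨b, Qx⟩` (print's «H*(Δ_π + DRD*) = ((QG₁Q*)⁻¹ − a)Q»).

HONEST SCOPE.  Pure algebra of the constructed letters; NO norm bound (the lattice-free size of `(QG₁Q*)⁻¹` is [5] Thm 3.11∕3.13 business —
`B9Eq3126QG1QInvPointDecayTower`, `B9Eq349QGGQInvSupRow`); NOT the re-typed Prop. 4 for `W80`; nothing printed asserted beyond the identity (129).
NOT summit progress (cell pub-balaban: NE9 NOT PRINTED ∕ NOT PROVED; spine PROVED 0∕9).  Imports `B11Eq103H1Complex` only.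
-/

noncomputable section

open scoped InnerProductSpace ComplexConjugate

namespace Literature.MathematicalPhysics.QuantumFieldTheory.Balaban1983to89.B11Eq88LaplaceH1Identity

open Literature.MathematicalPhysics.QuantumFieldTheory.Balaban1983to89.B11Eq103H1Complex
open B9SectCLatticeCarrier (Bond)

variable {𝕜 : Type*} [RCLike 𝕜] {d : ℕ} {Pd : Fin d → ℕ} {W : Type*} [NormedAddCommGroup W] [InnerProductSpace 𝕜 W] [FiniteDimensional 𝕜 W]
  {c₀ : ℝ} [Fact (0 < c₀)] {F : Type*} [NormedAddCommGroup F] [InnerProductSpace 𝕜 F] [FiniteDimensional 𝕜 F]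
  {c : 𝕜} {R S : Bond d Pd → W →ₗ[𝕜] W} {Δ₁ : BondL2K 𝕜 d Pd c₀ W →ₗ[𝕜] BondL2K 𝕜 d Pd c₀ W}
  {Rr : SiteL2K 𝕜 d Pd c₀ W →ₗ[𝕜] SiteL2K 𝕜 d Pd c₀ W} {Q : BondL2K 𝕜 d Pd c₀ W →ₗ[𝕜] F} {a : ℝ}
  (hpos : ∀ x : BondL2K 𝕜 d Pd c₀ W, x ≠ 0 → 0 < RCLike.re ⟪x, laplaceALatticeK c R S Δ₁ Rr Q a x⟫_𝕜) (hQ : Function.Surjective Q)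

/-! ## §1 `(Δ₁ + DRD*)H₁ = Q†((QG₁Q*)⁻¹ − a)` -/

/-- **`Δ_{1,a}(H₁b) = Q†(QG₁Q*)⁻¹b` ON THE LATTICE** — the abstract `laplaceAK_H1K` at the constructed letters `H1LatticeK`, `KinvLatticeK`.
[cite: Balaban1985Variational, (129) p.297, p.293] -/
theorem laplaceALatticeK_H1LatticeK (b : F) :
    laplaceALatticeK c R S Δ₁ Rr Q a (H1LatticeK hpos hQ b) = LinearMap.adjoint Q (KinvLatticeK hpos hQ b) :=
  laplaceAK_H1K hpos hadj_adjoint (adjoint_injective_of_surjective Q hQ) b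

/-- **(88)'s COMPOSITE: `Δ₁(H₁b) + D(R(D*(H₁b))) = Q†((QG₁Q*)⁻¹b) − a·Q†b`** — the second-order part `Δ₁ + DRD*` of `Δ_{1,a}` composed with `H₁` is an
averaging-side bounded operator (by `Δ_{1,a}H₁ = Q†K⁻¹` and (45) `QH₁ = 1`). [cite: Balaban1985Variational, (87)–(88) p.291, (129) p.297] -/
theorem laplace_add_DRD_H1LatticeK (b : F) :
    Δ₁ (H1LatticeK hpos hQ b) + covDerivL2K 𝕜 c₀ c R (Rr (covDivL2K 𝕜 c₀ c S (H1LatticeK hpos hQ b)))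
      = LinearMap.adjoint Q (KinvLatticeK hpos hQ b) - (a : 𝕜) • LinearMap.adjoint Q b := by
  have h := laplaceALatticeK_H1LatticeK (c := c) (R := R) (S := S) (Δ₁ := Δ₁) (Rr := Rr) (a := a) hpos hQ b
  rw [laplaceALatticeK, laplaceAK_apply, Q_H1LatticeK hpos hQ b, map_smul] at h
  rw [← h, add_sub_cancel_right]

/-! ## §2 The transposed (pairing) form: `H₁*Δ_{1,a} = ((QG₁Q*)⁻¹)*Q` -/

/-- **`⟨H₁b, Δ_{1,a}x⟩ = ⟨(QG₁Q*)⁻¹b, Qx⟩`** for a SYMMETRIC `Δ_{1,a}` (`Δ₁`, `R` symmetric, `D* = D†`, real `c`) — print's «`H*Δ̃ = K⁻¹Q`» read as a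
sesquilinear identity. [cite: Balaban1985Variational, (88) p.291, p.293] -/
theorem inner_H1LatticeK_laplaceALatticeK (hc : conj c = c) (hRS : ∀ (b : Bond d Pd) (v u : W), ⟪R b v, u⟫_𝕜 = ⟪v, S b u⟫_𝕜)
    (hΔ : Δ₁.IsSymmetric) (hR : Rr.IsSymmetric) (b : F) (x : BondL2K 𝕜 d Pd c₀ W) :
    ⟪H1LatticeK hpos hQ b, laplaceALatticeK c R S Δ₁ Rr Q a x⟫_𝕜 = ⟪KinvLatticeK hpos hQ b, Q x⟫_𝕜 := by
  rw [← laplaceALatticeK_isSymmetric hc hRS hΔ hR (H1LatticeK hpos hQ b) x, laplaceALatticeK_H1LatticeK hpos hQ b,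
    LinearMap.adjoint_inner_left]

/-- **`⟨H₁b, Δ₁x + D(R(D*x))⟩ = ⟨(QG₁Q*)⁻¹b, Qx⟩ − a⟨b, Qx⟩`** — the transposed composite of (88) («`𝔇*(A′)H*(Δ_π + DRD*)A′`»): `H₁*(Δ₁ + DRD*) =
((QG₁Q*)⁻¹ − a)*Q` as a sesquilinear identity (symmetric `Δ_{1,a}`). [cite: Balaban1985Variational, (87)–(88) p.291, p.293] -/
theorem inner_H1LatticeK_laplace_add_DRD (hc : conj c = c) (hRS : ∀ (b : Bond d Pd) (v u : W), ⟪R b v, u⟫_𝕜 = ⟪v, S b u⟫_𝕜)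
    (hΔ : Δ₁.IsSymmetric) (hR : Rr.IsSymmetric) (b : F) (x : BondL2K 𝕜 d Pd c₀ W) :
    ⟪H1LatticeK hpos hQ b, Δ₁ x + covDerivL2K 𝕜 c₀ c R (Rr (covDivL2K 𝕜 c₀ c S x))⟫_𝕜
      = ⟪KinvLatticeK hpos hQ b, Q x⟫_𝕜 - (a : 𝕜) * ⟪b, Q x⟫_𝕜 := by
  have h := inner_H1LatticeK_laplaceALatticeK (c := c) (R := R) (S := S) (Δ₁ := Δ₁) (Rr := Rr) (a := a) hpos hQ hc hRS hΔ hR b x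
  rw [laplaceALatticeK, laplaceAK_apply, inner_add_right, map_smul, inner_smul_right, LinearMap.adjoint_inner_right, Q_H1LatticeK hpos hQ b] at h
  rw [← sub_eq_iff_eq_add.2 h.symm]

end Literature.MathematicalPhysics.QuantumFieldTheory.Balaban1983to89.B11Eq88LaplaceH1Identity

end
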